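import Summits.ABC.ABC.Theses.FeketeScales
import Summits.ABC.ABC.Theorems.SparseGoodScales.Negative.SqfreeForms

/-!
# `SparseGoodScales` (stmt-ABC-2161): located abc triples of quality `2/3` in every window —
# `−1/3 < δ` is load-bearing in the drought / windowed stubs

Negative / tightness support lemmas for the crux `Summit.ABC.ABC.Theses.FeketeScales.SparseGoodScales`
(line lead c7, line `SketchIdeator4`, registered stub `stub_droughtsOfSomeRatio`, "DA∃":
`∀ δ > 0, ∃ Λ > 1, ∀ N, ∃ R ≥ N, ∀ abc, rad ≤ R → R < rad^Λ → c ≤ rad^{1+δ}`; and line `Sketch`'s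
`stub_windowedGoodScales`, "WGS": `… → c ≤ R^{1+δ}`).

Lead c6 (`Negative/WindowDensity.lean`) showed with the witnesses `(1, n, n+1)`, `n, n+1` squarefree
(quality `1/2`), that the drought matrix fails for every `δ ≤ −1/2` and the windowed statement for every
`δ < −1/2`, and left the near-hit range `δ ∈ (−1/2, 0]` open ("needs LOCATED radicals of near-hits").
Half of that range is elementary.  An abc triple whose radical is a product of RATIONAL LINEAR forms in
one parameter is located by squarefree sieving, and the polynomial identity `1 + (m−1)(m+1) = m²`
(all roots rational; Mason–Stothers-extremal) gives such a family of quality `2/3`: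

* by `Negative/SqfreeForms.lean`, every interval `(K, 2K]`, `K ≥ 1000`, contains `k` with `4k+1`, `2k+1`,
  `4k+3` squarefree; for `m = 4k+2` the three consecutive integers `m−1, m, m+1` are then squarefree
  and pairwise coprime, so `rad(1 · (m²−1) · m²) = (m²−1) m = m³ − m` EXACTLY (`rad_one_sq_pred_sq`);
* `exists_cubic_window` — hence for every `Λ > 1` (and every lower bound `M` on `m`) every large scale
  `R` carries such an `m ≥ M` with `m³ − m ≤ R < (m³ − m)^Λ` and `R < 16 (m³ − m)`;
* `not_droughtsAt_of_le_neg_third` — **the drought matrix fails for every `δ ≤ −1/3` and every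
  `Λ > 1`** (the witness has `c = m² > (m³ − m)^{2/3} ≥ rad^{1+δ}`), and
  `not_droughtsOfSomeRatioAt_of_le_neg_third` — so does the drought statement (`∃ Λ > 1, …`);
* `not_windowedAt_of_lt_neg_third` — **the windowed matrix fails for every `δ < −1/3` and every
  `Λ > 1`** (`R^{1+δ} < (16 m³)^{1+δ} < m² = c` once `m` is large), and
  `not_windowedGoodScalesAt_of_lt_neg_third` — so does the windowed statement (`∀ Λ > 1, …`).

So `−1/3 < δ` (not merely `−1/2 < δ`) is load-bearing in both windowed shapes.

Scope (honest): nothing here touches the crux (`δ > 0`).  Ceiling of the method: the same sieve locates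
the radicals of ANY identity `a(m) + b(m) = c(m)` whose roots are all rational, e.g.
`(u−1)(2u+1)² + 2 = (u+1)(2u−1)²` (quality `3/4`, would give `δ < −1/4`) and
`(m+1)³(m−3) + 16m = (m−1)³(m+3)` (quality `4/5`, `δ < −1/5`); by Mason–Stothers every such located
family has quality `< 1`, so `δ → 0⁻` and the disprover's near-miss `windowed_false_at_zero`
(Cruxes/SparseGoodScales/Disproof.lean §7) stay abc-strength (located radicals of near-HITS), exactly as
lead c6 and the Disproof §5 say.
-/

noncomputable section

set_option linter.dupNamespace false

namespace Summit.ABC.ABC.Theorems.SparseGoodScales.Negative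

open Literature.NumberTheory.DiophantineGeometry UniqueFactorizationMonoid Finset

/-! ## The witness triples `(1, m² − 1, m²)` -/

/-- `(1, m² − 1, m²)` is an abc triple for every `m ≥ 2`. [folklore] -/
theorem isABCTriple_one_sq_pred_sq {m : ℕ} (hm : 2 ≤ m) : IsABCTriple 1 (m * m - 1) (m * m) := by
  have h4 : 4 ≤ m * m := by nlinarith
  exact ⟨one_pos, by omega, by omega, Nat.coprime_one_left _⟩

/-- For `(m² − 1) m` squarefree the radical of `(1, m² − 1, m²)` is EXACTLY `(m² − 1) m = m³ − m`
(`m²` and `m` have the same prime factors). [folklore] -/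
theorem rad_one_sq_pred_sq {m : ℕ} (hm : 2 ≤ m) (hsq : Squarefree ((m * m - 1) * m)) :
    rad 1 (m * m - 1) (m * m) = (m * m - 1) * m := by
  have hm0 : m ≠ 0 := by omega
  have h4 : 4 ≤ m * m := by nlinarith
  have hb0 : m * m - 1 ≠ 0 := by omega
  rw [rad_def, one_mul, Nat.radical_eq_prod_primeFactors,
    Nat.primeFactors_mul hb0 (mul_ne_zero hm0 hm0), Nat.primeFactors_mul hm0 hm0, Finset.union_self]
  conv_rhs => rw [← Nat.prod_primeFactors_of_squarefree hsq, Nat.primeFactors_mul hb0 hm0]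

/-! ## Every window `(R^{1/Λ}, R]` carries a located cubic radical -/

/-- **Located cubic radicals in every window.**  For every `Λ > 1` and every `M` there is `N` such that
every scale `R ≥ N` admits `m ≥ M` (`m ≥ 2`) with `(m² − 1) m` squarefree,
`(m² − 1) m ≤ R < ((m² − 1) m)^Λ` and `R < 16 (m² − 1) m`.  (Let `K` be the largest integer with
`(8K+2)³ ≤ R`; pick `k ∈ (K, 2K]` by `exists_sqfreeForms_Ioc` and `m = 4k+2 ≤ 8K+2`; then
`m³ ≤ R < (8K+10)³ ≤ (2m)³ ≤ 16 (m³ − m)`, and `(R/16)^Λ > R` once `R > 16^{Λ/(Λ−1)}`.) [folklore] -/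
theorem exists_cubic_window {Λ : ℝ} (hΛ : 1 < Λ) (M : ℕ) :
    ∃ N : ℕ, ∀ R : ℕ, N ≤ R → ∃ m : ℕ, M ≤ m ∧ 2 ≤ m ∧ Squarefree ((m * m - 1) * m) ∧
      (m * m - 1) * m ≤ R ∧ (R : ℝ) < 16 * (((m * m - 1) * m : ℕ) : ℝ) ∧
      (R : ℝ) < ((((m * m - 1) * m : ℕ)) : ℝ) ^ Λ := by
  have hΛ1 : 0 < Λ - 1 := by linarith
  set C : ℝ := (16 : ℝ) ^ (Λ / (Λ - 1)) with hC
  set K₁ : ℕ := max 1000 M with hK₁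
  refine ⟨max ((8 * K₁ + 10) ^ 3) (⌈C⌉₊ + 1), fun R hR => ?_⟩
  have hR1 : (8 * K₁ + 10) ^ 3 ≤ R := le_trans (le_max_left _ _) hR
  have hR2 : ⌈C⌉₊ + 1 ≤ R := le_trans (le_max_right _ _) hR
  -- `K` := the largest `K ≤ R` with `(8K+2)^3 ≤ R`; then `K₁ ≤ K` and `R < (8K+10)^3`
  have hPK1 : (8 * K₁ + 2) ^ 3 ≤ R := le_trans (Nat.pow_le_pow_left (by omega) 3) hR1
  have hK1R : K₁ ≤ R :=
    le_trans (le_trans (by omega : K₁ ≤ 8 * K₁ + 10) (Nat.le_self_pow (by norm_num) _)) hR1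
  set K := Nat.findGreatest (fun K => (8 * K + 2) ^ 3 ≤ R) R with hKdef
  have hK1K : K₁ ≤ K := Nat.le_findGreatest hK1R hPK1
  have hPK : (8 * K + 2) ^ 3 ≤ R := Nat.findGreatest_spec (P := fun K => (8 * K + 2) ^ 3 ≤ R) hK1R hPK1
  have hKR : K ≤ R := Nat.findGreatest_le R
  have hnPR : ¬ (8 * R + 2) ^ 3 ≤ R := by
    intro h
    have : R < (8 * R + 2) ^ 3 :=
      lt_of_lt_of_le (by omega : R < 8 * R + 2) (Nat.le_self_pow (by norm_num) _)
    exact absurd h (not_le.mpr this)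
  have hKlt : K < R := by
    refine lt_of_le_of_ne hKR fun hEq => ?_
    rw [hEq] at hPK
    exact hnPR hPK
  have hnP : ¬ (8 * (K + 1) + 2) ^ 3 ≤ R :=
    Nat.findGreatest_is_greatest (P := fun K => (8 * K + 2) ^ 3 ≤ R) (Nat.lt_succ_self K) hKlt
  have hRlt : R < (8 * K + 10) ^ 3 := by
    rw [show 8 * K + 10 = 8 * (K + 1) + 2 by ring]
    exact not_le.mp hnP
  have hK1000 : 1000 ≤ K := le_trans (le_max_left _ _) hK1K
  have hKM : M ≤ K := le_trans (le_max_right _ _) hK1K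
  -- the good `k ∈ (K, 2K]` and `m = 4k + 2`
  obtain ⟨k, hKk, hk2K, hs1, hs2, hs3⟩ := exists_sqfreeForms_Ioc hK1000
  set m : ℕ := 4 * k + 2 with hmdef
  have hsq : Squarefree ((m * m - 1) * m) := squarefree_cubic_of_forms hs1 hs2 hs3
  have hm2 : 2 ≤ m := by omega
  have hmlo : 4 * K + 6 ≤ m := by omega
  have hmhi : m ≤ 8 * K + 2 := by omega
  have h4 : 4 ≤ m * m := by nlinarith
  refine ⟨m, by omega, hm2, hsq, ?_, ?_, ?_⟩
  · -- `(m² − 1) m ≤ m³ ≤ (8K+2)³ ≤ R`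
    have h1 : (m * m - 1) * m ≤ m * m * m := Nat.mul_le_mul_right _ (Nat.sub_le _ _)
    have h2 : m * m * m ≤ (8 * K + 2) * (8 * K + 2) * (8 * K + 2) :=
      Nat.mul_le_mul (Nat.mul_le_mul hmhi hmhi) hmhi
    have h3 : (8 * K + 2) ^ 3 = (8 * K + 2) * (8 * K + 2) * (8 * K + 2) := by ring
    omega
  · -- `R < (8K+10)³ ≤ (2m)³ = 8 m³ ≤ 16 (m³ − m)`
    have h1 : ((R : ℕ) : ℝ) < (((8 * K + 10) ^ 3 : ℕ) : ℝ) := by exact_mod_cast hRlt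
    have h2 : ((4 * K + 6 : ℕ) : ℝ) ≤ (m : ℝ) := by exact_mod_cast hmlo
    have h3 : (2 : ℝ) ≤ m := by exact_mod_cast hm2
    have hcast : (((m * m - 1) * m : ℕ) : ℝ) = ((m : ℝ) * m - 1) * m := by
      rw [Nat.cast_mul, Nat.cast_sub (by omega : 1 ≤ m * m)]
      push_cast
      ring
    rw [hcast]
    push_cast at h1 h2
    have h5 : (8 * (K : ℝ) + 10) ^ 3 ≤ (2 * (m : ℝ) - 2) ^ 3 :=
      pow_le_pow_left₀ (by positivity) (by linarith) 3
    have h6 : (2 * (m : ℝ) - 2) ^ 3 ≤ 16 * (((m : ℝ) * m - 1) * m) := by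
      nlinarith [h3, sq_nonneg (m : ℝ), mul_nonneg (by linarith : (0 : ℝ) ≤ m - 2) (sq_nonneg (m : ℝ))]
    linarith
  · -- `R < 16 r` and `R > 16^{Λ/(Λ−1)}` give `R < r^Λ`
    have hcast : (((m * m - 1) * m : ℕ) : ℝ) = ((m : ℝ) * m - 1) * m := by
      rw [Nat.cast_mul, Nat.cast_sub (by omega : 1 ≤ m * m)]
      push_cast
      ring
    have hlow : (R : ℝ) < 16 * (((m * m - 1) * m : ℕ) : ℝ) := by
      have h1 : ((R : ℕ) : ℝ) < (((8 * K + 10) ^ 3 : ℕ) : ℝ) := by exact_mod_cast hRlt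
      have h2 : ((4 * K + 6 : ℕ) : ℝ) ≤ (m : ℝ) := by exact_mod_cast hmlo
      have h3 : (2 : ℝ) ≤ m := by exact_mod_cast hm2
      rw [hcast]
      push_cast at h1 h2
      have h5 : (8 * (K : ℝ) + 10) ^ 3 ≤ (2 * (m : ℝ) - 2) ^ 3 :=
        pow_le_pow_left₀ (by positivity) (by linarith) 3
      have h6 : (2 * (m : ℝ) - 2) ^ 3 ≤ 16 * (((m : ℝ) * m - 1) * m) := by
        nlinarith [h3, sq_nonneg (m : ℝ), mul_nonneg (by linarith : (0 : ℝ) ≤ m - 2) (sq_nonneg (m : ℝ))]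
      linarith
    have hRpos : (0 : ℝ) < R := by
      have : ((8 * K₁ + 10) ^ 3 : ℕ) ≤ R := hR1
      have h' : 0 < (8 * K₁ + 10) ^ 3 := by positivity
      exact_mod_cast lt_of_lt_of_le h' this
    have hRM : C < R := by
      have h1 : C ≤ ⌈C⌉₊ := Nat.le_ceil C
      have h2 : ((⌈C⌉₊ + 1 : ℕ) : ℝ) ≤ R := by exact_mod_cast hR2
      push_cast at h2
      linarith
    have hC0 : (0 : ℝ) < 16 := by norm_num
    have hM0 : 0 ≤ C := Real.rpow_nonneg hC0.le _
    have hkey : (16 : ℝ) ^ Λ < (R : ℝ) ^ (Λ - 1) := by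
      have h := Real.rpow_lt_rpow hM0 hRM hΛ1
      rwa [hC, ← Real.rpow_mul hC0.le, div_mul_cancel₀ _ hΛ1.ne'] at h
    have hRΛ : (R : ℝ) * (16 : ℝ) ^ Λ < (R : ℝ) ^ Λ := by
      have h1 : (R : ℝ) ^ Λ = (R : ℝ) ^ (Λ - 1) * R := by
        rw [← Real.rpow_add_one hRpos.ne' (Λ - 1)]
        ring_nf
      rw [h1, mul_comm ((R : ℝ) ^ (Λ - 1))]
      exact mul_lt_mul_of_pos_left hkey hRpos
    have hCΛ : (0 : ℝ) < (16 : ℝ) ^ Λ := Real.rpow_pos_of_pos hC0 Λ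
    have hdiv : (R : ℝ) < ((R : ℝ) / 16) ^ Λ := by
      rw [Real.div_rpow hRpos.le hC0.le, lt_div_iff₀ hCΛ]
      exact hRΛ
    have hrad : (R : ℝ) / 16 < (((m * m - 1) * m : ℕ) : ℝ) := by
      rw [div_lt_iff₀ hC0]
      linarith
    calc (R : ℝ) < ((R : ℝ) / 16) ^ Λ := hdiv
      _ < ((((m * m - 1) * m : ℕ) : ℝ)) ^ Λ :=
          Real.rpow_lt_rpow (by positivity) hrad (by linarith)

/-- **Located abc triples of quality `2/3` in every window.**  For every `Λ > 1` there is `N` such that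
every scale `R ≥ N` carries an abc triple `(1, m² − 1, m²)` with radical EXACTLY `(m² − 1) m` and
`rad ≤ R < rad^Λ`, `R < 16 rad`. [folklore] -/
theorem exists_cubicTriple_rad_mem_window {Λ : ℝ} (hΛ : 1 < Λ) :
    ∃ N : ℕ, ∀ R : ℕ, N ≤ R → ∃ m : ℕ, 2 ≤ m ∧ IsABCTriple 1 (m * m - 1) (m * m) ∧
      rad 1 (m * m - 1) (m * m) = (m * m - 1) * m ∧ rad 1 (m * m - 1) (m * m) ≤ R ∧
      (R : ℝ) < ((rad 1 (m * m - 1) (m * m) : ℕ) : ℝ) ^ Λ ∧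
      (R : ℝ) < 16 * ((rad 1 (m * m - 1) (m * m) : ℕ) : ℝ) := by
  obtain ⟨N, hN⟩ := exists_cubic_window hΛ 0
  refine ⟨N, fun R hR => ?_⟩
  obtain ⟨m, -, hm2, hsq, hle, h16, hlt⟩ := hN R hR
  have hrad := rad_one_sq_pred_sq hm2 hsq
  refine ⟨m, hm2, isABCTriple_one_sq_pred_sq hm2, hrad, ?_, ?_, ?_⟩
  · rwa [hrad]
  · rwa [hrad]
  · rwa [hrad]

/-! ## Consequences: `−1/3 < δ` is load-bearing in the drought stub and in the windowed stub -/

/-- Key inequality for the witness: `((m² − 1) m)^e < m²` whenever `e ≤ 2/3` (and `m ≥ 2`). [folklore] -/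
theorem sq_gt_rpow_cubic {m : ℕ} (hm : 2 ≤ m) {e : ℝ} (he : e ≤ 2 / 3) :
    ((((m * m - 1) * m : ℕ)) : ℝ) ^ e < ((m * m : ℕ) : ℝ) := by
  have h4 : 4 ≤ m * m := by nlinarith
  have hbase : (1 : ℝ) ≤ (((m * m - 1) * m : ℕ) : ℝ) := by
    have : 1 ≤ (m * m - 1) * m := by
      have : 3 ≤ m * m - 1 := by omega
      nlinarith
    exact_mod_cast this
  have h1 : (((m * m - 1) * m : ℕ) : ℝ) ^ e ≤ (((m * m - 1) * m : ℕ) : ℝ) ^ ((2 : ℝ) / 3) :=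
    Real.rpow_le_rpow_of_exponent_le hbase he
  have h2 : (((m * m - 1) * m : ℕ) : ℝ) < ((m : ℕ) : ℝ) ^ (3 : ℕ) := by
    have : (m * m - 1) * m < m ^ 3 := by
      have h' : m * m - 1 < m * m := Nat.sub_lt (by omega) one_pos
      calc (m * m - 1) * m < m * m * m := Nat.mul_lt_mul_of_pos_right h' (by omega)
        _ = m ^ 3 := by ring
    exact_mod_cast this
  have h3 : (((m * m - 1) * m : ℕ) : ℝ) ^ ((2 : ℝ) / 3) < (((m : ℕ) : ℝ) ^ (3 : ℕ)) ^ ((2 : ℝ) / 3) :=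
    Real.rpow_lt_rpow (by positivity) h2 (by norm_num)
  have h4' : (((m : ℕ) : ℝ) ^ (3 : ℕ)) ^ ((2 : ℝ) / 3) = ((m * m : ℕ) : ℝ) := by
    rw [← Real.rpow_natCast, ← Real.rpow_mul (by positivity),
      show ((3 : ℕ) : ℝ) * ((2 : ℝ) / 3) = (2 : ℕ) by norm_num, Real.rpow_natCast]
    push_cast
    ring
  linarith [h4' ▸ h3]

/-- **The drought matrix fails for every `δ ≤ −1/3` and every `Λ > 1`.**  (Body of
`stub_droughtsOfSomeRatio` with `δ`, `Λ` free: `∀ N ∃ R ≥ N ∀ abc, rad ≤ R → R < rad^Λ → c ≤ rad^{1+δ}`.)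
The witness `(1, m² − 1, m²)` of `exists_cubic_window` sits in the window and has
`c = m² > (m³ − m)^{2/3} ≥ rad^{1+δ}`.  Sharpens `not_droughtsAt_of_le_neg_half` (lead c6). [folklore] -/
theorem not_droughtsAt_of_le_neg_third {δ : ℝ} (hδ : δ ≤ -1 / 3) {Λ : ℝ} (hΛ : 1 < Λ) :
    ¬ ∀ N : ℕ, ∃ R : ℕ, N ≤ R ∧ ∀ a b c : ℕ, IsABCTriple a b c → rad a b c ≤ R →
      (R : ℝ) < ((rad a b c : ℕ) : ℝ) ^ Λ → (c : ℝ) ≤ ((rad a b c : ℕ) : ℝ) ^ (1 + δ) := by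
  intro h
  obtain ⟨N, hN⟩ := exists_cubic_window hΛ 0
  obtain ⟨R, hNR, hR⟩ := h N
  obtain ⟨m, -, hm2, hsq, hle, -, hlt⟩ := hN R hNR
  have ht := isABCTriple_one_sq_pred_sq hm2
  have hrad := rad_one_sq_pred_sq hm2 hsq
  have hc := hR 1 (m * m - 1) (m * m) ht (by rw [hrad]; exact hle) (by rw [hrad]; exact hlt)
  rw [hrad] at hc
  have hgt := sq_gt_rpow_cubic hm2 (e := 1 + δ) (by linarith)
  linarith

/-- **The drought STATEMENT fails for every `δ ≤ −1/3`**: no ratio `Λ > 1` admits arbitrarily large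
drought scales at exponent `1 + δ ≤ 2/3`.  (`stub_droughtsOfSomeRatio` with `δ` free and `0 < δ`
replaced by `δ ≤ −1/3` is false; `−1/3 < δ` is load-bearing.) [folklore] -/
theorem not_droughtsOfSomeRatioAt_of_le_neg_third {δ : ℝ} (hδ : δ ≤ -1 / 3) :
    ¬ ∃ Λ : ℝ, 1 < Λ ∧ ∀ N : ℕ, ∃ R : ℕ, N ≤ R ∧ ∀ a b c : ℕ,
      IsABCTriple a b c → rad a b c ≤ R → (R : ℝ) < ((rad a b c : ℕ) : ℝ) ^ Λ →
        (c : ℝ) ≤ ((rad a b c : ℕ) : ℝ) ^ (1 + δ) := by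
  rintro ⟨Λ, hΛ, hmat⟩
  exact not_droughtsAt_of_le_neg_third hδ hΛ hmat

/-- **The windowed matrix fails for every `δ < −1/3` and every `Λ > 1`.**  (Body of line `Sketch`'s
`stub_windowedGoodScales` with `δ`, `Λ` free: `∀ N ∃ R ≥ N ∀ abc, rad ≤ R → R < rad^Λ → c ≤ R^{1+δ}`.)
For the witness of `exists_cubic_window` one has `R < 16 (m³ − m) < 16 m³`, so
`R^{1+δ} < 16^{1+δ} m^{3(1+δ)} < m² = c` as soon as `m^{2 − 3(1+δ)} > 16^{1+δ}` (and trivially when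
`1 + δ ≤ 0`).  Sharpens `not_windowedAt_of_le_neg_one` (lead c6). [folklore] -/
theorem not_windowedAt_of_lt_neg_third {δ : ℝ} (hδ : δ < -1 / 3) {Λ : ℝ} (hΛ : 1 < Λ) :
    ¬ ∀ N : ℕ, ∃ R : ℕ, N ≤ R ∧ ∀ a b c : ℕ, IsABCTriple a b c → rad a b c ≤ R →
      (R : ℝ) < ((rad a b c : ℕ) : ℝ) ^ Λ → (c : ℝ) ≤ (R : ℝ) ^ (1 + δ) := by
  intro h
  by_cases hδ1 : δ ≤ -1
  · obtain ⟨N, hN⟩ := exists_cubic_window hΛ 0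
    obtain ⟨R, hNR, hR⟩ := h (max N 1)
    obtain ⟨m, -, hm2, hsq, hle, -, hlt⟩ := hN R (le_trans (le_max_left _ _) hNR)
    have ht := isABCTriple_one_sq_pred_sq hm2
    have hrad := rad_one_sq_pred_sq hm2 hsq
    have hc := hR 1 (m * m - 1) (m * m) ht (by rw [hrad]; exact hle) (by rw [hrad]; exact hlt)
    have hR1 : (1 : ℝ) ≤ R := by exact_mod_cast le_trans (le_max_right N 1) hNR
    have hpow : (R : ℝ) ^ (1 + δ) ≤ 1 := Real.rpow_le_one_of_one_le_of_nonpos hR1 (by linarith)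
    have hc4 : (4 : ℝ) ≤ ((m * m : ℕ) : ℝ) := by
      have : 4 ≤ m * m := by nlinarith
      exact_mod_cast this
    linarith
  · have h1δ : 0 < 1 + δ := by linarith [lt_of_not_ge hδ1]
    set η : ℝ := 2 - 3 * (1 + δ) with hη
    have hη0 : 0 < η := by rw [hη]; linarith
    set B : ℝ := (16 : ℝ) ^ ((1 + δ) / η) with hB
    have hB0 : 0 ≤ B := Real.rpow_nonneg (by norm_num) _
    obtain ⟨N, hN⟩ := exists_cubic_window hΛ (⌈B⌉₊ + 1)
    obtain ⟨R, hNR, hR⟩ := h N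
    obtain ⟨m, hMm, hm2, hsq, hle, h16, hlt⟩ := hN R hNR
    have ht := isABCTriple_one_sq_pred_sq hm2
    have hrad := rad_one_sq_pred_sq hm2 hsq
    have hc := hR 1 (m * m - 1) (m * m) ht (by rw [hrad]; exact hle) (by rw [hrad]; exact hlt)
    -- `R < 16 m³`
    have hm0 : (0 : ℝ) < m := by exact_mod_cast (by omega : 0 < m)
    have hr3 : (((m * m - 1) * m : ℕ) : ℝ) < (m : ℝ) ^ (3 : ℕ) := by
      have : (m * m - 1) * m < m ^ 3 := by
        have h' : m * m - 1 < m * m := Nat.sub_lt (by nlinarith) one_pos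
        calc (m * m - 1) * m < m * m * m := Nat.mul_lt_mul_of_pos_right h' (by omega)
          _ = m ^ 3 := by ring
      exact_mod_cast this
    have hR16 : (R : ℝ) < 16 * (m : ℝ) ^ (3 : ℕ) := by linarith
    have hRpos : (0 : ℝ) ≤ R := by positivity
    have step1 : (R : ℝ) ^ (1 + δ) < (16 * (m : ℝ) ^ (3 : ℕ)) ^ (1 + δ) :=
      Real.rpow_lt_rpow hRpos hR16 h1δ
    have step2 : (16 * (m : ℝ) ^ (3 : ℕ)) ^ (1 + δ) = (16 : ℝ) ^ (1 + δ) * (m : ℝ) ^ (3 * (1 + δ)) := by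
      rw [Real.mul_rpow (by norm_num) (by positivity), ← Real.rpow_natCast,
        ← Real.rpow_mul hm0.le]
      norm_num
    -- `16^{1+δ} < m^η` because `m > B = 16^{(1+δ)/η}`
    have hBm : B < m := by
      have h1 : B ≤ ⌈B⌉₊ := Nat.le_ceil B
      have h2 : ((⌈B⌉₊ + 1 : ℕ) : ℝ) ≤ m := by exact_mod_cast hMm
      push_cast at h2
      linarith
    have step3 : (16 : ℝ) ^ (1 + δ) < (m : ℝ) ^ η := by
      have h := Real.rpow_lt_rpow hB0 hBm hη0
      rwa [hB, ← Real.rpow_mul (by norm_num : (0 : ℝ) ≤ 16), div_mul_cancel₀ _ hη0.ne'] at h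
    have step4 : (m : ℝ) ^ η * (m : ℝ) ^ (3 * (1 + δ)) = ((m * m : ℕ) : ℝ) := by
      rw [← Real.rpow_add hm0, show η + 3 * (1 + δ) = (2 : ℕ) by rw [hη]; push_cast; ring,
        Real.rpow_natCast]
      push_cast
      ring
    have hpos3 : (0 : ℝ) < (m : ℝ) ^ (3 * (1 + δ)) := Real.rpow_pos_of_pos hm0 _
    have step5 : (16 : ℝ) ^ (1 + δ) * (m : ℝ) ^ (3 * (1 + δ)) < (m : ℝ) ^ η * (m : ℝ) ^ (3 * (1 + δ)) :=
      mul_lt_mul_of_pos_right step3 hpos3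
    rw [step4] at step5
    rw [step2] at step1
    linarith

/-- **The windowed STATEMENT fails for every `δ < −1/3`.**  (Line `Sketch`'s `stub_windowedGoodScales`
with `δ` free: `∀ Λ > 1, ∀ N, ∃ R ≥ N, ∀ abc, rad ≤ R → R < rad^Λ → c ≤ R^{1+δ}`; sharpens
`not_windowedGoodScalesAt_of_lt_neg_half` of lead c6: `−1/3 ≤ δ` is load-bearing.) [folklore] -/
theorem not_windowedGoodScalesAt_of_lt_neg_third {δ : ℝ} (hδ : δ < -1 / 3) :
    ¬ ∀ Λ : ℝ, 1 < Λ → ∀ N : ℕ, ∃ R : ℕ, N ≤ R ∧ ∀ a b c : ℕ, IsABCTriple a b c →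
      rad a b c ≤ R → (R : ℝ) < ((rad a b c : ℕ) : ℝ) ^ Λ → (c : ℝ) ≤ (R : ℝ) ^ (1 + δ) :=
  fun h => not_windowedAt_of_lt_neg_third hδ (Λ := 2) (by norm_num) (h 2 (by norm_num))

end Summit.ABC.ABC.Theorems.SparseGoodScales.Negative
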